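import Summits.ResolutionOfSingularities.ResolutionOfSingularities.Theorems.WildConesClassicalRegimesStubMuDropCharTwoOrdPInduction

/-!
# Crux `IsolatedJacobianDrop` (stmt-ResolutionOfSingularities-18946, route `JacobianBudget`) —
# the SURFACE budget `Δ₂(p) = p² − p − 1`, formal part (every characteristic `p`)

For the budget crux `Theses.JacobianBudget.IsolatedJacobianDrop` in `n = 2` variables the decrement is
`Δ₂(p) = p² − p − 1`. This file proves the FORMAL inequality behind it, for every prime `p` and every
field `κ` of characteristic `p`: if `a ∈ κ⟦x, y⟧` has order `≥ p + 1` and `T` is its transform under the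
point blow-up in the chart `i` at the point `τ` with ONE power of the exceptional variable less than
the order removed,

  `X_i ^ p * T = a∘Φ_{i,τ}`   (`Φ_{i,τ} : X_i ↦ X_i, X_s ↦ X_i (X_s + τ_s)`),

and both Milnor algebras `κ⟦x,y⟧/(∂a)`, `κ⟦x,y⟧/(∂T)` are finite, then

  `dim_κ κ⟦x,y⟧/(∂T) + p·p ≤ dim_κ κ⟦x,y⟧/(∂a) + (p + 1)`     (`surface_budget_any`).

This is VERBATIM the mechanism of the characteristic-two surface leaf
`MuDropCharTwoOrdP.surface_drop` (helper 8/8 of crux `ClassicalRegimes`) with `2 ↦ p` and the sharp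
count kept: after the shear `y ↦ y + τ x` (`shear_transfer_order`), the chain rule in characteristic `p`
(`p · X^{p-1} = 0`) gives `∂_y T = x · H₁`, `∂_x T = H₀ + y · H₁` with the weak transforms
`H₀ = x^{m_f - p} f'`, `H₁ = x^{m_g - p} g'` of the polars `f = ∂_x a`, `g = ∂_y a` (orders `m_f, m_g ≥ p`,
strict transforms `f', g'`); additivity of colengths along the exceptional line
(`colength_X_mul`, `colength_X_pow_mul`) splits `dim/(∂T)` into the contact `ν ≤ p + 1` of `∂_x T` with
the exceptional line, `(m - p)·ρ` with `ρ ≤ p`, and `dim/(f', g')`, and MAX NOETHER'S INEQUALITY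
`dim/(f', g') + m_f m_g ≤ dim/(f, g)` (`MuDropCharTwoOrdP.noether_inequality`, landed) closes the count.
Either chart by renaming the two variables (`surface_budget_any`).

The route-level consequence — the one-step budget `μ(step i τ c) + Δ₂(p) ≤ μ(c)` for two-variable states
of the point-blow-up dynamics — is the leaf `Theorems/JacobianBudgetIsolatedJacobianDropSurface.lean`.

BANK item of chain W4.1 (campaign res-hironaka, rung L, slot W4.1), explicitly not summit progress.
Everything here is OURS and elementary over the landed kit; it replaces the role of no printed item and
is NOT a statement of Hironaka's manuscript. Sources: E. Casas-Alvero, *Singular Points of Plane Curves*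
(2000), §3.3 (Noether's formula); A. van den Essen, LNM 712 (1979) (the `n = 2` Milnor budget of a
foliation, characteristic zero). [folklore]
-/

noncomputable section

-- single-problem summit: the doubled namespace component `ResolutionOfSingularities` is forced
set_option linter.dupNamespace false

open scoped BigOperators Classical

open MvPowerSeries IsLocalRing

open Literature.AlgebraicGeometry.Resolution

open Summit.ResolutionOfSingularities.ResolutionOfSingularities.Theorems.WildCones.MuDropCharTwoOrdP

namespace Summit.ResolutionOfSingularities.ResolutionOfSingularities.Theorems.JacobianBudget

namespace SurfaceBudget

variable {κ : Type} [Field κ]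

/-! ## Small tools -/

/-- In characteristic `p`, `∂ₛ (X_t ^ p * g) = X_t ^ p * ∂ₛ g`. [folklore] -/
theorem pderiv_X_pow_p_mul {p : ℕ} [CharP κ p] {n : ℕ} (s t : Fin n) (g : MvPowerSeries (Fin n) κ) :
    MvPowerSeries.pderiv s (X t ^ p * g) = X t ^ p * MvPowerSeries.pderiv s g := by
  have hp0 : (p : MvPowerSeries (Fin n) κ) = 0 := by
    rw [← map_natCast (C : κ →+* MvPowerSeries (Fin n) κ) p, CharP.cast_eq_zero, map_zero]
  rw [Derivation.leibniz, Derivation.leibniz_pow, smul_eq_mul, smul_eq_mul, nsmul_eq_mul, hp0,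
    zero_mul, mul_zero, add_zero]

/-- The partials of a series of order `≥ N + 1` have order `≥ N`. [folklore] -/
theorem le_order_pderiv {n : ℕ} {N : ℕ} {a : MvPowerSeries (Fin n) κ}
    (ha : ((N + 1 : ℕ) : ℕ∞) ≤ a.order) (s : Fin n) :
    (N : ℕ∞) ≤ (MvPowerSeries.pderiv s a).order := by
  apply nat_le_order
  intro d hd
  rw [MvPowerSeries.coeff_pderiv]
  have : coeff (d + Finsupp.single s 1) a = 0 := by
    apply coeff_of_lt_order
    refine lt_of_lt_of_le ?_ ha
    have hdeg : (d + Finsupp.single s 1).degree = d.degree + 1 := by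
      rw [map_add, Finsupp.degree_single]
    exact_mod_cast (show (d + Finsupp.single s 1).degree < N + 1 by rw [hdeg]; omega)
  rw [this, mul_zero]

/-- THE SHEAR `y ↦ y + t x` transports a series to the chart of slope `0` without changing the Milnor
algebra or the order filtration (any characteristic; the Milnor-algebra part is verbatim that of
`MuDropCharTwoOrdP.shear_transfer`). [folklore] -/
theorem shear_transfer_order (t : κ) {a : MvPowerSeries (Fin 2) κ} {N : ℕ} (ha : (N : ℕ∞) ≤ a.order) :
    ∃ a₁ : MvPowerSeries (Fin 2) κ,
      subst (PlaneGerm.dirChart t) a = subst (![X 0, X 0 * X 1] : Fin 2 → MvPowerSeries (Fin 2) κ) a₁ ∧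
      (N : ℕ∞) ≤ a₁.order ∧
      Nonempty ((MvPowerSeries (Fin 2) κ ⧸ Ideal.span (Set.range fun s => MvPowerSeries.pderiv s a)) ≃ₐ[κ]
        (MvPowerSeries (Fin 2) κ ⧸ Ideal.span (Set.range fun s => MvPowerSeries.pderiv s a₁))) := by
  have range_fin_two : ∀ {α : Type} (h : Fin 2 → α), Set.range h = {h 0, h 1} := fun h => by
    ext x
    simp only [Set.mem_range, Set.mem_insert_iff, Set.mem_singleton_iff]
    constructor
    · rintro ⟨s, rfl⟩; fin_cases s <;> simp
    · rintro (rfl | rfl) <;> exact ⟨_, rfl⟩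
  have h0 := PlaneGerm.constantCoeff_shearX (k := κ) t
  obtain ⟨L, hL⟩ := exists_algEquiv_of_subst _ h0 (PlaneGerm.isUnit_det_shearX t)
  refine ⟨L a, by rw [hL, PlaneGerm.subst_dirChart], le_order_algEquiv L ha, ?_⟩
  refine ⟨Ideal.quotientEquivAlg _ _ L ?_⟩
  rw [Ideal.map_span, ← Set.range_comp, range_fin_two, range_fin_two]
  simp only [Function.comp_apply]
  have hcr : ∀ m, MvPowerSeries.pderiv m (L a) =
      ∑ s, L (MvPowerSeries.pderiv s a) * MvPowerSeries.pderiv m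
        ((![X 0, X 1 + C t * X 0] : Fin 2 → MvPowerSeries (Fin 2) κ) s) := by
    intro m
    rw [hL, MvPowerSeries.pderiv_subst h0]
    simp only [hL]
  have h0' : MvPowerSeries.pderiv 0 (L a) = L (MvPowerSeries.pderiv 0 a) + C t * L (MvPowerSeries.pderiv 1 a) := by
    rw [hcr, Fin.sum_univ_two]
    simp only [Matrix.cons_val_zero, Matrix.cons_val_one, map_add, MvPowerSeries.pderiv_X,
      Derivation.leibniz, pderiv_C, smul_eq_mul]
    simp
    ring
  have h1' : MvPowerSeries.pderiv 1 (L a) = L (MvPowerSeries.pderiv 1 a) := by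
    rw [hcr, Fin.sum_univ_two]
    simp only [Matrix.cons_val_zero, Matrix.cons_val_one, map_add, MvPowerSeries.pderiv_X,
      Derivation.leibniz, pderiv_C, smul_eq_mul]
    simp
  change Ideal.span {MvPowerSeries.pderiv 0 (L a), MvPowerSeries.pderiv 1 (L a)} =
    Ideal.span {L (MvPowerSeries.pderiv 0 a), L (MvPowerSeries.pderiv 1 a)}
  rw [h0', h1', Ideal.span_pair_add_mul_right]

/-! ## The surface budget in the chart of the first variable -/

/-- **THE SURFACE BUDGET, chart `X 0`** (characteristic `p`): for `a ∈ κ⟦x,y⟧` of order `≥ p + 1` and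
`T` with `x^p T = a∘Φ_{0,τ}`, both Milnor algebras finite,
`dim_κ κ⟦x,y⟧/(∂T) + p·p ≤ dim_κ κ⟦x,y⟧/(∂a) + (p + 1)`. Shear to slope `0`; chain rule in
characteristic `p`; weak transforms of the polars; additivity of colengths along the exceptional line;
Max Noether's inequality. [folklore] -/
theorem surface_budget {p : ℕ} [CharP κ p] (hp : p.Prime) (τ : Fin 2 → κ) {a T : MvPowerSeries (Fin 2) κ}
    (ha : ((p + 1 : ℕ) : ℕ∞) ≤ a.order)
    (hT : X 0 ^ p * T = subst (fun s => if s = (0 : Fin 2) then (X 0 : MvPowerSeries (Fin 2) κ)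
      else X 0 * (X s + C (τ s))) a)
    (hfa : Module.Finite κ (MvPowerSeries (Fin 2) κ ⧸ Ideal.span (Set.range fun s => MvPowerSeries.pderiv s a)))
    (hfT : Module.Finite κ (MvPowerSeries (Fin 2) κ ⧸ Ideal.span (Set.range fun s => MvPowerSeries.pderiv s T))) :
    Module.finrank κ (MvPowerSeries (Fin 2) κ ⧸ Ideal.span (Set.range fun s => MvPowerSeries.pderiv s T)) + p * p ≤
      Module.finrank κ (MvPowerSeries (Fin 2) κ ⧸ Ideal.span (Set.range fun s => MvPowerSeries.pderiv s a)) +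
        (p + 1) := by
  have range_fin_two : ∀ {α : Type} (h : Fin 2 → α), Set.range h = {h 0, h 1} := fun h => by
    ext x
    simp only [Set.mem_range, Set.mem_insert_iff, Set.mem_singleton_iff]
    constructor
    · rintro ⟨s, rfl⟩; fin_cases s <;> simp
    · rintro (rfl | rfl) <;> exact ⟨_, rfl⟩
  have finOne_eq_single : ∀ m : Fin 1 →₀ ℕ, m = Finsupp.single 0 (m 0) := fun m =>
    Finsupp.ext fun s => by fin_cases s; simp
  have hp1 : 1 ≤ p := hp.one_le
  set e : Fin 1 ↪ Fin 2 := ⟨fun _ => (1 : Fin 2), fun a b _ => Subsingleton.elim a b⟩ with he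
  -- STEP 1: the shear
  rw [blowFam_two_eq_dirChart] at hT
  obtain ⟨a₁, ha₁, ha₁ord, ⟨ε⟩⟩ := shear_transfer_order (τ 1) ha
  rw [ha₁] at hT
  rw [ε.toLinearEquiv.finrank_eq]
  haveI hfa₁ : Module.Finite κ (MvPowerSeries (Fin 2) κ ⧸
      Ideal.span (Set.range fun s => MvPowerSeries.pderiv s a₁)) := Module.Finite.equiv ε.toLinearEquiv
  clear hfa ha ha₁
  rw [range_fin_two] at hfa₁ ⊢
  rw [range_fin_two] at hfT ⊢
  -- the chain rule in characteristic `p`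
  have hB0 : ∀ s, constantCoeff ((![X 0, X 0 * X 1] : Fin 2 → MvPowerSeries (Fin 2) κ) s) = 0 := by
    intro s; fin_cases s <;> simp [constantCoeff_X]
  have hrel1 : X 0 ^ p * MvPowerSeries.pderiv 1 T = X 0 * subst ![X 0, X 0 * X 1] (MvPowerSeries.pderiv 1 a₁) := by
    have h := congrArg (MvPowerSeries.pderiv 1) hT
    rw [pderiv_X_pow_p_mul, MvPowerSeries.pderiv_subst hB0, Fin.sum_univ_two] at h
    rw [h]
    simp only [Matrix.cons_val_zero, Matrix.cons_val_one, MvPowerSeries.pderiv_X, Derivation.leibniz,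
      smul_eq_mul]
    simp
    ring
  have hrel0 : X 0 ^ p * MvPowerSeries.pderiv 0 T = subst ![X 0, X 0 * X 1] (MvPowerSeries.pderiv 0 a₁) +
      X 1 * subst ![X 0, X 0 * X 1] (MvPowerSeries.pderiv 1 a₁) := by
    have h := congrArg (MvPowerSeries.pderiv 0) hT
    rw [pderiv_X_pow_p_mul, MvPowerSeries.pderiv_subst hB0, Fin.sum_univ_two] at h
    rw [h]
    simp only [Matrix.cons_val_zero, Matrix.cons_val_one, MvPowerSeries.pderiv_X, Derivation.leibniz,
      smul_eq_mul]
    simp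
    ring
  -- STEP 2: the partials of `a₁`
  set f := MvPowerSeries.pderiv 0 a₁ with hf
  set g := MvPowerSeries.pderiv 1 a₁ with hg
  have hfp : (p : ℕ∞) ≤ f.order := le_order_pderiv ha₁ord 0
  have hgp : (p : ℕ∞) ≤ g.order := le_order_pderiv ha₁ord 1
  have hfmem : f ∈ maximalIdeal (MvPowerSeries (Fin 2) κ) := by
    rw [Literature.RingTheory.MvPowerSeries.Jets.mem_maximalIdeal_iff_constantCoeff_eq_zero,
      ← coeff_zero_eq_constantCoeff_apply]
    exact coeff_of_lt_order (lt_of_lt_of_le (by exact_mod_cast hp.pos) hfp)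
  have hgmem : g ∈ maximalIdeal (MvPowerSeries (Fin 2) κ) := by
    rw [Literature.RingTheory.MvPowerSeries.Jets.mem_maximalIdeal_iff_constantCoeff_eq_zero,
      ← coeff_zero_eq_constantCoeff_apply]
    exact coeff_of_lt_order (lt_of_lt_of_le (by exact_mod_cast hp.pos) hgp)
  have hf0 : f ≠ 0 := by
    intro h0
    rw [h0, Ideal.span_insert_zero] at hfa₁
    exact not_finite_quot_span {g} (by simpa using hgmem) (by simp) (by rw [Finset.coe_singleton]; exact hfa₁)
  have hg0 : g ≠ 0 := by
    intro h0
    rw [h0, Ideal.span_pair_zero] at hfa₁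
    exact not_finite_quot_span {f} (by simpa using hfmem) (by simp) (by rw [Finset.coe_singleton]; exact hfa₁)
  set mf := f.order.toNat with hmf
  set mg := g.order.toNat with hmg
  have hordf : (mf : ℕ∞) = f.order := ne_zero_iff_order_finite.mp hf0
  have hordg : (mg : ℕ∞) = g.order := ne_zero_iff_order_finite.mp hg0
  have hmfp : p ≤ mf := by have := hfp; rw [← hordf] at this; exact_mod_cast this
  have hmgp : p ≤ mg := by have := hgp; rw [← hordg] at this; exact_mod_cast this
  obtain ⟨f', hff', hKf, hνf⟩ := exists_strict_transform hf0
  obtain ⟨g', hgg', hKg, hνg⟩ := exists_strict_transform hg0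
  have hνf' : (killCompl e f').order.toNat ≤ mf := by
    have h := hνf; rw [← ne_zero_iff_order_finite.mp hKf] at h; exact_mod_cast h
  have hνg' : (killCompl e g').order.toNat ≤ mg := by
    have h := hνg; rw [← ne_zero_iff_order_finite.mp hKg] at h; exact_mod_cast h
  have hff'' : subst ![X 0, X 0 * X 1] f = X 0 ^ mf * f' := hff'
  have hgg'' : subst ![X 0, X 0 * X 1] g = X 0 ^ mg * g' := hgg'
  have hpf : (X 0 : MvPowerSeries (Fin 2) κ) ^ mf = X 0 ^ p * X 0 ^ (mf - p) := by
    rw [← pow_add]; congr 1; omega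
  have hpg : (X 0 : MvPowerSeries (Fin 2) κ) ^ mg = X 0 ^ p * X 0 ^ (mg - p) := by
    rw [← pow_add]; congr 1; omega
  have hX0 : (X 0 : MvPowerSeries (Fin 2) κ) ^ p ≠ 0 := pow_ne_zero _ (FormalCoordChange.X_ne_zero' 0)
  -- the strict transforms are not divisible by `x`
  have hndvd : ∀ {h : MvPowerSeries (Fin 2) κ}, killCompl e h ≠ 0 → ¬ (X 0 : MvPowerSeries (Fin 2) κ) ∣ h := by
    intro h hh ⟨w, hw⟩
    apply hh
    rw [hw, map_mul, killCompl_X_eq_zero (fun h' => ((range_axisEmb 0).mp h').1 rfl), zero_mul]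
  -- `∂₁ T = x H₁`, `∂₀ T = H₀ + y H₁` with the WEAK transforms `H₀ = x^{mf-p} f'`, `H₁ = x^{mg-p} g'`
  set H₀ := X 0 ^ (mf - p) * f' with hH₀
  set H₁ := X 0 ^ (mg - p) * g' with hH₁
  have hd1 : MvPowerSeries.pderiv 1 T = X 0 * H₁ := by
    apply mul_left_cancel₀ hX0
    rw [hrel1, hgg'', hH₁, hpg]; ring
  have hd0 : MvPowerSeries.pderiv 0 T = H₀ + X 1 * H₁ := by
    apply mul_left_cancel₀ hX0
    rw [hrel0, hff'', hgg'', hH₀, hH₁, hpf, hpg]; ring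
  rw [hd0, hd1] at hfT ⊢
  set P := H₀ + X 1 * H₁ with hP
  -- `x ∤ ∂₀ T`
  have hPndvd : ¬ (X 0 : MvPowerSeries (Fin 2) κ) ∣ P := by
    intro hdvd
    refine not_finite_quot_of_le_span (I := Ideal.span {P, X 0 * H₁}) {X 0} ?_ (by simp) ?_ hfT
    · simp only [Finset.coe_singleton, Set.singleton_subset_iff, SetLike.mem_coe]
      exact X_mem_maximalIdeal κ (Fin 2) 0
    · rw [Finset.coe_singleton, Ideal.span_le]
      intro z hz
      simp only [Set.mem_insert_iff, Set.mem_singleton_iff] at hz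
      rcases hz with rfl | rfl
      · exact Ideal.mem_span_singleton.mpr hdvd
      · exact Ideal.mem_span_singleton.mpr (dvd_mul_right _ _)
  obtain ⟨hfinPx, hfinPH, hsum⟩ := colength_X_mul hPndvd hfT
  -- `ν = dim S/(P, x) ≤ p + 1`: the `x`-free slice of `P = ∂₀ T` is the dehomogenised leading form
  have hKP : killCompl e P ≠ 0 := by
    intro h0
    apply hPndvd
    have hmem : P ∈ RingHom.ker (killCompl (R := κ) e : MvPowerSeries (Fin 2) κ →+* MvPowerSeries (Fin 1) κ) := h0
    have := ker_killCompl_le e range_axisEmb hmem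
    rw [Set.pair_eq_singleton, Ideal.mem_span_singleton] at this
    exact this
  obtain ⟨-, hν⟩ := colength_X_eq_order hKP
  rw [Ideal.span_pair_comm] at hν
  change _ = (killCompl e P).order.toNat at hν
  have hνp : (killCompl e P).order.toNat ≤ p + 1 := by
    obtain ⟨d, hd, hdeg⟩ := exists_coeff_ne_zero_and_order (ne_zero_iff_order_finite.mp hKP)
    rw [finOne_eq_single d, Finsupp.degree_single] at hdeg
    have hq : d 0 ≤ p + 1 := by
      by_contra hlt
      apply hd
      rw [finOne_eq_single d, coeff_killCompl_axis, ← hd0, MvPowerSeries.coeff_pderiv]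
      have hexp : (Finsupp.single 0 (p + 1) + Finsupp.single 1 (d 0) : Fin 2 →₀ ℕ) - Finsupp.single 0 p =
          Finsupp.single 1 (d 0) + Finsupp.single 0 1 := by
        apply Finsupp.ext; intro s; fin_cases s <;> simp
      have h1 : coeff (Finsupp.single 1 (d 0) + Finsupp.single 0 1) T =
          coeff (Finsupp.single 0 (p + 1) + Finsupp.single 1 (d 0)) (X 0 ^ p * T) := by
        rw [X_pow_eq, coeff_monomial_mul, if_pos, one_mul, hexp]
        rw [Finsupp.single_le_iff]; simp
      rw [h1, hT, coeff_subst_blow', (finTwo_pair_apply _ _).1, (finTwo_pair_apply _ _).2, if_neg (by omega),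
        mul_zero]
    have : (killCompl e P).order.toNat = d 0 := by
      have := congrArg ENat.toNat hdeg
      simpa using this.symm
    omega
  -- not both orders exceed `p`
  have hcase : mf = p ∨ mg = p := by
    by_contra hc
    push Not at hc
    apply hPndvd
    rw [hP, hH₀, hH₁, show mf - p = (mf - p - 1) + 1 by omega, show mg - p = (mg - p - 1) + 1 by omega,
      pow_succ, pow_succ]
    exact Dvd.intro (X 0 ^ (mf - p - 1) * f' + X 1 * (X 0 ^ (mg - p - 1) * g')) (by ring)
  -- Max Noether for `(f, g)`
  have hN : Module.Finite κ (MvPowerSeries (Fin 2) κ ⧸ Ideal.span {f', g'}) →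
      Module.finrank κ (MvPowerSeries (Fin 2) κ ⧸ Ideal.span {f', g'}) + mf * mg ≤
        Module.finrank κ (MvPowerSeries (Fin 2) κ ⧸ Ideal.span {f, g}) := fun hfin' =>
    noether_inequality hordf.le hordg.le hff' hgg' hKf (hνf.trans (by exact_mod_cast Nat.le_add_right mf mg))
      hfa₁ hfin'
  -- the two cases
  rcases hcase with hmf2' | hmg2'
  · -- `mf = p`: `H₀ = f'`
    have hH₀' : H₀ = f' := by rw [hH₀, hmf2', Nat.sub_self, pow_zero, one_mul]
    have hspan : Ideal.span {P, H₁} = Ideal.span {f', X 0 ^ (mg - p) * g'} := by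
      rw [hP, Ideal.span_pair_add_mul_right, hH₀', hH₁]
    rw [hspan] at hfinPH hsum
    obtain ⟨hfin', hsum'⟩ := colength_X_pow_mul (hndvd hKf) (mg - p) hfinPH
    obtain ⟨-, hρ⟩ := colength_X_eq_order hKf
    rw [Ideal.span_pair_comm] at hρ
    change _ = (killCompl e f').order.toNat at hρ
    have hρ2 : Module.finrank κ (MvPowerSeries (Fin 2) κ ⧸ Ideal.span {f', (X 0 : MvPowerSeries (Fin 2) κ)}) ≤ p := by
      rw [hρ]; exact hνf'.trans hmf2'.le
    have hN' := hN hfin'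
    rw [hmf2'] at hN'
    have hprod := Nat.mul_le_mul_left (mg - p)
      (show Module.finrank κ (MvPowerSeries (Fin 2) κ ⧸ Ideal.span {f', (X 0 : MvPowerSeries (Fin 2) κ)}) ≤ p
        from hρ2)
    have hmul : p * mg = p * p + (mg - p) * p := by
      obtain ⟨k, hk⟩ := Nat.exists_eq_add_of_le hmgp
      rw [hk, Nat.add_sub_cancel_left]; ring
    rw [hsum, hν, hsum']
    rw [hmul] at hN'
    omega
  · -- `mg = p`: `H₁ = g'`
    have hH₁' : H₁ = g' := by rw [hH₁, hmg2', Nat.sub_self, pow_zero, one_mul]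
    have hspan : Ideal.span {P, H₁} = Ideal.span {g', X 0 ^ (mf - p) * f'} := by
      rw [hP, Ideal.span_pair_add_mul_right, hH₁', hH₀, Ideal.span_pair_comm]
    rw [hspan] at hfinPH hsum
    obtain ⟨hfin', hsum'⟩ := colength_X_pow_mul (hndvd hKg) (mf - p) hfinPH
    rw [Ideal.span_pair_comm (x := g') (y := f')] at hfin' hsum'
    obtain ⟨-, hρ⟩ := colength_X_eq_order hKg
    rw [Ideal.span_pair_comm] at hρ
    change _ = (killCompl e g').order.toNat at hρ
    have hρ2 : Module.finrank κ (MvPowerSeries (Fin 2) κ ⧸ Ideal.span {g', (X 0 : MvPowerSeries (Fin 2) κ)}) ≤ p := by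
      rw [hρ]; exact hνg'.trans hmg2'.le
    have hN' := hN hfin'
    rw [hmg2'] at hN'
    have hprod := Nat.mul_le_mul_left (mf - p)
      (show Module.finrank κ (MvPowerSeries (Fin 2) κ ⧸ Ideal.span {g', (X 0 : MvPowerSeries (Fin 2) κ)}) ≤ p
        from hρ2)
    have hmul : mf * p = p * p + (mf - p) * p := by
      obtain ⟨k, hk⟩ := Nat.exists_eq_add_of_le hmfp
      rw [hk, Nat.add_sub_cancel_left]; ring
    rw [hsum, hν, hsum']
    rw [hmul] at hN'
    omega

/-! ## Either chart -/

/-- **THE SURFACE BUDGET, either chart**: `surface_budget` after renaming the two variables when the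
chart index is `1`. [folklore] -/
theorem surface_budget_any {p : ℕ} [CharP κ p] (hp : p.Prime) (i : Fin 2) (τ : Fin 2 → κ)
    {a T : MvPowerSeries (Fin 2) κ} (ha : ((p + 1 : ℕ) : ℕ∞) ≤ a.order)
    (hT : X i ^ p * T = subst (fun s => if s = i then (X i : MvPowerSeries (Fin 2) κ)
      else X i * (X s + C (τ s))) a)
    (hfa : Module.Finite κ (MvPowerSeries (Fin 2) κ ⧸ Ideal.span (Set.range fun s => MvPowerSeries.pderiv s a)))
    (hfT : Module.Finite κ (MvPowerSeries (Fin 2) κ ⧸ Ideal.span (Set.range fun s => MvPowerSeries.pderiv s T))) :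
    Module.finrank κ (MvPowerSeries (Fin 2) κ ⧸ Ideal.span (Set.range fun s => MvPowerSeries.pderiv s T)) + p * p ≤
      Module.finrank κ (MvPowerSeries (Fin 2) κ ⧸ Ideal.span (Set.range fun s => MvPowerSeries.pderiv s a)) +
        (p + 1) := by
  by_cases hi : i = 0
  · subst hi
    exact surface_budget hp τ ha hT hfa hfT
  · have hi1 : i = 1 := by
      fin_cases i
      · exact absurd rfl hi
      · rfl
    subst hi1
    set w : Fin 2 ≃ Fin 2 := Equiv.swap 0 1 with hw
    have hw1 : w 1 = 0 := by rw [hw, Equiv.swap_apply_right]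
    obtain ⟨εa⟩ := milnorAlg_equiv_rename w a
    obtain ⟨εT⟩ := milnorAlg_equiv_rename w T
    haveI hfa' : Module.Finite κ (MvPowerSeries (Fin 2) κ ⧸
        Ideal.span (Set.range fun s => MvPowerSeries.pderiv s (rename w a))) :=
      Module.Finite.equiv εa.toLinearEquiv
    haveI hfT' : Module.Finite κ (MvPowerSeries (Fin 2) κ ⧸
        Ideal.span (Set.range fun s => MvPowerSeries.pderiv s (rename w T))) :=
      Module.Finite.equiv εT.toLinearEquiv
    rw [εa.toLinearEquiv.finrank_eq, εT.toLinearEquiv.finrank_eq]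
    have hT' : X (0 : Fin 2) ^ p * rename w T = subst (fun s => if s = (0 : Fin 2) then
        (X 0 : MvPowerSeries (Fin 2) κ) else X 0 * (X s + C ((fun t => τ (w.symm t)) s))) (rename w a) := by
      have h := congrArg (rename w) hT
      rw [map_mul, map_pow, rename_X, hw1, rename_subst_blowFam, hw1] at h
      exact h
    refine surface_budget hp (fun t => τ (w.symm t)) ?_ hT' hfa' hfT'
    have := le_order_algEquiv (renameEquiv κ w) ha
    rwa [renameEquiv_apply] at this

end SurfaceBudget

end Summit.ResolutionOfSingularities.ResolutionOfSingularities.Theorems.JacobianBudget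

end
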